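import Summits.AtomisticToContinuum.Crystallization.Theorems.FrustratedLawDichotomyNoTwistOfPairBound

/-!
# FrustratedLawDichotomy · crux `AperiodicFrustratedLawGap` (stmt-AtomisticToContinuum-27623) — `P = CapForcing θ` FROM FOUR 12-POINT
# SCALAR BOUNDS: no two-link certificate and no cap-match certificate (decomp-a2c, prover hand 2, gen 10)

Assembly of the lens route: at every corner of a classified link the half-cap exists — at hcp path-type corners combinatorially (CORNER
PAIRING I/II, p821792/p821922), at all other corners from the `√3`-bound `LinkPairBound θ D₀ √3 Pat` (`noTwist_of_pairBound`, p823632-series) —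
and the two half-caps of a square coincide by `CapMatchCert ⟸ LinkDiagonalBound θ d₀ Pat` (p823469).  Hence

* `hcp_degree_sum_one_of_diagonal_of_pathType` — transport of the converse pairing rule at path-type corners (a diagonal pair has degree sum `1`);
* `halfCaps_fcc_of_pairBound`, `halfCaps_hcp_of_pairBound` — half-caps at every corner (the hypothesis of `capForcingAt_of_halfCap`, p823174);
* ★ `capForcing_of_scalarBounds` : `LinkPairBound θ D₀ √3 (fcc, hcp) ∧ LinkDiagonalBound θ d₀ (fcc, hcp)` + the two numerical lens conditions
  `⟹ CapForcing θ`;  at the registered literal: `capForcing_hundredth_of_scalarBounds` with `D₀ = 17/10`, `d₀ = 6/5`;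
* ★ by name: `kr2Shape_of_scalarBounds` (`LinkCert(1/100) ∧` four scalar bounds `∧ CappedCert(1/100,1/20) ×2 ⟹ KR2Shape`),
  `aperiodicFrustratedLawGap_of_scalarBounds` (crux, given `MuEquilibriumDoor ∧ ChargedEnergyGap`), `noFrustratedPeriodicMinimiser_of_scalarBounds`.
The geometric side of the FLD column: `LinkCert(1/100)` (G), FOUR scalar single-link bounds (P), `CappedCert(1/100,1/20)` fcc/hcp (M).
`[folklore]` bookkeeping; def-free; no `sorry`; no `instance`/`notation`.
-/

noncomputable section

namespace Summit.AtomisticToContinuum.Crystallization.Theorems.FrustratedLawDichotomyScalarBoundsP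

open Literature.Geometry.DiscreteGeometry
open Summit.AtomisticToContinuum.Crystallization.Theses.PricedLinkCensus (ChargedEnergyGap)
open Summit.AtomisticToContinuum.Crystallization.Theorems.FrustratedLawDichotomyTwoShellRigidityCut
  (E3 LinkIso CapForcing KR2Shape kr2Shape_of_cut aperiodicFrustratedLawGap_of_cut noFrustratedPeriodicMinimiser_of_cut)
open Summit.AtomisticToContinuum.Crystallization.Theorems.FrustratedLawDichotomyLinkIsoToolkit (injective_of_linkIso)
open Summit.AtomisticToContinuum.Crystallization.Theorems.FrustratedLawDichotomyCappedRigidityCert (CappedCert)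
open Summit.AtomisticToContinuum.Crystallization.Theorems.FrustratedLawDichotomyCappedRigidityCertPatterns
  (dist_eq_one_iff_sqNormInt dist_eq_sqrt_two_iff_sqNormInt cappedRigidity_of_cert fcc_contactSeparating hcp_contactSeparating)
open Summit.AtomisticToContinuum.Crystallization.Theorems.FrustratedLawDichotomyLinkCert (LinkCert linkClassification_of_linkCert)
open Summit.AtomisticToContinuum.Crystallization.Theorems.FrustratedLawDichotomyCornerPairing
  (exists_partner ncard_common_contacts_eq_of_shared_bond ncard_common_contacts_scaledPattern exists_int_of_mem_scaledPattern
    hcpInt_diagonal_iff_degree_sum_one_of_pathType fcc_not_pathType not_pathType_of_fcc_neighbour)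
open Summit.AtomisticToContinuum.Crystallization.Theorems.FrustratedLawDichotomyCornerPairingHalfCap
  (hcp_ncard_common_contacts_of_diagonal exists_halfCap_of_pathType_corner)
open Summit.AtomisticToContinuum.Crystallization.Theorems.FrustratedLawDichotomyHalfCap
  (fcc_ncard_common_contacts_of_diagonal fcc_common_contacts_not_adj hcp_common_contacts_not_adj exists_halfCap_of_diagonal_partners)
open Summit.AtomisticToContinuum.Crystallization.Theorems.FrustratedLawDichotomyNoTwistSwap
  (fcc_exists_diagonal_partner fcc_diagonal_partner_unique hcp_exists_diagonal_partner hcp_pathType_of_two_diagonal_partners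
    dist_centre_partner_eq_one linkIso_rebase)
open Summit.AtomisticToContinuum.Crystallization.Theorems.FrustratedLawDichotomyEightCerts (capForcingAt_of_halfCap)
open Summit.AtomisticToContinuum.Crystallization.Theorems.FrustratedLawDichotomyCapMatchOfDiagonal
  (LinkDiagonalBound capMatchCert_of_linkDiagonalBound capMatchCert_of_linkDiagonalBound_hundredth)
open Summit.AtomisticToContinuum.Crystallization.Theorems.FrustratedLawDichotomyNoTwistOfPairBound
  (LinkPairBound noTwist_of_pairBound fcc_dist_sqrt_three_of_corner hcp_dist_sqrt_three_of_corner)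

variable {θ : ℝ} {N : ℕ} {y : Fin N → E3} {i : Fin N}

/-! ### §1 Path-type corners: a diagonal pair has degree sum one (transport) -/

/-- **hcp: at a path-type corner `w`, two distinct contacts forming a diagonal pair have degrees inside `C(w)` summing to `1`.** [folklore] -/
theorem hcp_degree_sum_one_of_diagonal_of_pathType (w : ↥hcpKissingPattern)
    (hw : ∃ b : ↥hcpKissingPattern, dist (w : E3) (b : E3) = 1 ∧
      ({c : ↥hcpKissingPattern | dist (w : E3) (c : E3) = 1} ∩ {c : ↥hcpKissingPattern | dist (b : E3) (c : E3) = 1}).ncard = 2)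
    (x' y' : ↥hcpKissingPattern) (hx : dist (w : E3) (x' : E3) = 1) (hy : dist (w : E3) (y' : E3) = 1) (hne : x' ≠ y')
    (hdiag : dist (x' : E3) (y' : E3) = Real.sqrt 2) :
    ({c : ↥hcpKissingPattern | dist (w : E3) (c : E3) = 1} ∩ {c : ↥hcpKissingPattern | dist (x' : E3) (c : E3) = 1}).ncard +
      ({c : ↥hcpKissingPattern | dist (w : E3) (c : E3) = 1} ∩ {c : ↥hcpKissingPattern | dist (y' : E3) (c : E3) = 1}).ncard = 1 := by
  have h18 : (18 : ℕ) ≠ 0 := by norm_num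
  obtain ⟨b', hb', hdeg⟩ := hw
  obtain ⟨v₀, hv₀, hv⟩ := exists_int_of_mem_scaledPattern w
  obtain ⟨b₀, hb₀, hb⟩ := exists_int_of_mem_scaledPattern b'
  obtain ⟨x₀, hx₀, hxv⟩ := exists_int_of_mem_scaledPattern x'
  obtain ⟨y₀, hy₀, hyv⟩ := exists_int_of_mem_scaledPattern y'
  have hdeg' : (hcpInt.filter (fun c => sqNormInt (v₀ - c) = ((18 : ℕ) : ℤ) ∧ sqNormInt (b₀ - c) = ((18 : ℕ) : ℤ))).card = 2 := by
    rw [← ncard_common_contacts_scaledPattern h18 w b' hv hb]; exact hdeg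
  have hvb : sqNormInt (v₀ - b₀) = ((18 : ℕ) : ℤ) := by
    rw [← hv, ← hb] at hb'; exact (dist_eq_one_iff_sqNormInt h18 v₀ b₀).1 hb'
  have hvx : sqNormInt (v₀ - x₀) = ((18 : ℕ) : ℤ) := by
    rw [← hv, ← hxv] at hx; exact (dist_eq_one_iff_sqNormInt h18 v₀ x₀).1 hx
  have hvy : sqNormInt (v₀ - y₀) = ((18 : ℕ) : ℤ) := by
    rw [← hv, ← hyv] at hy; exact (dist_eq_one_iff_sqNormInt h18 v₀ y₀).1 hy
  have hxy : x₀ ≠ y₀ := by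
    intro h; apply hne; apply Subtype.ext; rw [← hxv, ← hyv, h]
  have hd : sqNormInt (x₀ - y₀) = 2 * ((18 : ℕ) : ℤ) := by
    rw [← hxv, ← hyv] at hdiag; exact (dist_eq_sqrt_two_iff_sqNormInt h18 x₀ y₀).1 hdiag
  have key := (hcpInt_diagonal_iff_degree_sum_one_of_pathType v₀ hv₀ ⟨b₀, hb₀, hvb, hdeg'⟩ x₀ hx₀ y₀ hy₀ hvx hvy hxy).2 hd
  rw [← ncard_common_contacts_scaledPattern h18 w x' hv hxv, ← ncard_common_contacts_scaledPattern h18 w y' hv hyv] at key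
  exact key

/-! ### §2 Half-caps at every corner from the `√3`-bound -/

/-- **Half-caps at every corner of an fcc-classified centre from `LinkPairBound θ D₀ √3 fcc`.** [folklore] -/
theorem halfCaps_fcc_of_pairBound {D₀ : ℝ} (hB : LinkPairBound θ D₀ (Real.sqrt 3) fccKissingPattern) (hθ : 0 ≤ θ) (hD₀ : 0 < D₀)
    (hnum : 3 * (((1 + θ) ^ 2) ^ 2 - D₀ ^ 2 / 4) < (1 + θ)⁻¹ ^ 2 - ((((1 + θ) ^ 2) ^ 2 - (1 + θ)⁻¹ ^ 2) / D₀) ^ 2) :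
    ∀ {N : ℕ} {y : Fin N → E3} {i : Fin N} {τ : ↥fccKissingPattern → Fin N}, Function.Injective y →
      LinkIso θ fccKissingPattern y i τ →
      (∀ j : Fin N, (bondGraph θ y).Adj i j →
        (∃ τ' : ↥fccKissingPattern → Fin N, LinkIso θ fccKissingPattern y j τ') ∨
          (∃ τ' : ↥hcpKissingPattern → Fin N, LinkIso θ hcpKissingPattern y j τ')) →
      ∀ (w u v : ↥fccKissingPattern), dist (w : E3) (u : E3) = 1 → dist (w : E3) (v : E3) = 1 →
        dist (u : E3) (v : E3) = Real.sqrt 2 →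
        ∃ m : Fin N, m ≠ i ∧ (bondGraph θ y).Adj m (τ u) ∧ (bondGraph θ y).Adj m (τ v) ∧ (bondGraph θ y).Adj m (τ w) ∧
          m ∉ Set.range τ := by
  intro N y i τ hy hL hnb w u v hwu hwv huv
  have hτ : Function.Injective τ := injective_of_linkIso fcc_contactSeparating hL
  have hF2 : ∀ x : ↥fccKissingPattern, dist (w : E3) (x : E3) = 1 → dist (u : E3) (x : E3) = Real.sqrt 2 → x = v :=
    fun x hwx hux => fcc_diagonal_partner_unique w u x v hwu hwx hwv hux huv
  have hS3 : ∀ x : ↥fccKissingPattern, dist (w : E3) (x : E3) = 1 → u ≠ x → dist (u : E3) (x : E3) ≠ 1 →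
      dist (u : E3) (x : E3) ≠ Real.sqrt 2 → dist (u : E3) (x : E3) = Real.sqrt 3 :=
    fun x hwx hne h1 h2 => fcc_dist_sqrt_three_of_corner w u x hwu hwx hne h1 h2
  rcases hnb (τ w) (hL.1 w) with ⟨τ', hL'⟩ | ⟨τ', hL'⟩
  · obtain ⟨w', hw'⟩ := hL'.2.1 i (hL.1 w).symm
    have hτ' : Function.Injective τ' := injective_of_linkIso fcc_contactSeparating hL'
    obtain ⟨a', ha'w, ha', -⟩ := exists_partner hτ' hL w hL' hw' hwu
    obtain ⟨b', hb'w, hb', -⟩ := exists_partner hτ' hL w hL' hw' hwv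
    have hdiag : dist (a' : E3) (b' : E3) = Real.sqrt 2 :=
      noTwist_of_pairBound fcc_contactSeparating fcc_contactSeparating hB hθ hD₀ hnum hy hL w hL' hw' hwu ha' hb'
        (fcc_exists_diagonal_partner w' a' ha'w) hF2 hS3 fcc_ncard_common_contacts_of_diagonal
        (fun u' v' c c' h h1 h2 h3 h4 hne => fcc_common_contacts_not_adj u' v' c c' h h1 h2 h3 h4 hne)
    exact exists_halfCap_of_diagonal_partners hτ' hL w hL' hw' ha'w hb'w ha' hb' hdiag
      (fcc_ncard_common_contacts_of_diagonal a' b' hdiag)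
      (fun c c' h1 h2 h3 h4 hne => fcc_common_contacts_not_adj a' b' c c' hdiag h1 h2 h3 h4 hne)
  · obtain ⟨w', hw'⟩ := hL'.2.1 i (hL.1 w).symm
    have hτ' : Function.Injective τ' := injective_of_linkIso hcp_contactSeparating hL'
    have hLw : LinkIso θ fccKissingPattern y (τ' w') τ := linkIso_rebase hL hw'
    obtain ⟨a', ha'w, ha', -⟩ := exists_partner hτ' hL w hL' hw' hwu
    obtain ⟨b', hb'w, hb', -⟩ := exists_partner hτ' hL w hL' hw' hwv
    -- the neighbour's corner w' is not path-type (a degree-2 contact would transfer to the fcc corner w)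
    have hw'np : ¬ ∃ b₀ : ↥hcpKissingPattern, dist (w' : E3) (b₀ : E3) = 1 ∧
        ({c : ↥hcpKissingPattern | dist (w' : E3) (c : E3) = 1} ∩ {c : ↥hcpKissingPattern | dist (b₀ : E3) (c : E3) = 1}).ncard = 2 := by
      rintro ⟨b₀, hb₀, hdeg2⟩
      obtain ⟨b₁, hb₁w, hb₁, -⟩ := exists_partner hτ hL' w' hLw (w' := w) rfl hb₀
      refine fcc_not_pathType w ⟨b₁, hb₁w, ?_⟩
      rw [← ncard_common_contacts_eq_of_shared_bond hτ' hτ hL' w' hLw (w' := w) rfl hb₁]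
      exact hdeg2
    have hdiag : dist (a' : E3) (b' : E3) = Real.sqrt 2 :=
      noTwist_of_pairBound fcc_contactSeparating hcp_contactSeparating hB hθ hD₀ hnum hy hL w hL' hw' hwu ha' hb'
        (hcp_exists_diagonal_partner w' a' hw'np ha'w) hF2 hS3 hcp_ncard_common_contacts_of_diagonal
        (fun u' v' c c' h h1 h2 h3 h4 hne => hcp_common_contacts_not_adj u' v' c c' h h1 h2 h3 h4 hne)
    exact exists_halfCap_of_diagonal_partners hτ' hL w hL' hw' ha'w hb'w ha' hb' hdiag
      (hcp_ncard_common_contacts_of_diagonal a' b' hdiag)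
      (fun c c' h1 h2 h3 h4 hne => hcp_common_contacts_not_adj a' b' c c' hdiag h1 h2 h3 h4 hne)

/-- **Half-caps at every corner of an hcp-classified centre from `LinkPairBound θ D₀ √3 hcp`** (path-type corners combinatorially). [folklore] -/
theorem halfCaps_hcp_of_pairBound {D₀ : ℝ} (hB : LinkPairBound θ D₀ (Real.sqrt 3) hcpKissingPattern) (hθ : 0 ≤ θ) (hD₀ : 0 < D₀)
    (hnum : 3 * (((1 + θ) ^ 2) ^ 2 - D₀ ^ 2 / 4) < (1 + θ)⁻¹ ^ 2 - ((((1 + θ) ^ 2) ^ 2 - (1 + θ)⁻¹ ^ 2) / D₀) ^ 2) :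
    ∀ {N : ℕ} {y : Fin N → E3} {i : Fin N} {τ : ↥hcpKissingPattern → Fin N}, Function.Injective y →
      LinkIso θ hcpKissingPattern y i τ →
      (∀ j : Fin N, (bondGraph θ y).Adj i j →
        (∃ τ' : ↥fccKissingPattern → Fin N, LinkIso θ fccKissingPattern y j τ') ∨
          (∃ τ' : ↥hcpKissingPattern → Fin N, LinkIso θ hcpKissingPattern y j τ')) →
      ∀ (w u v : ↥hcpKissingPattern), dist (w : E3) (u : E3) = 1 → dist (w : E3) (v : E3) = 1 →
        dist (u : E3) (v : E3) = Real.sqrt 2 →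
        ∃ m : Fin N, m ≠ i ∧ (bondGraph θ y).Adj m (τ u) ∧ (bondGraph θ y).Adj m (τ v) ∧ (bondGraph θ y).Adj m (τ w) ∧
          m ∉ Set.range τ := by
  intro N y i τ hy hL hnb w u v hwu hwv huv
  have hτ : Function.Injective τ := injective_of_linkIso hcp_contactSeparating hL
  have huv_ne : u ≠ v := by
    intro h; rw [h, dist_self] at huv; exact (Real.sqrt_pos.2 (by norm_num : (0 : ℝ) < 2)).ne huv
  by_cases hpt : ∃ b₀ : ↥hcpKissingPattern, dist (w : E3) (b₀ : E3) = 1 ∧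
      ({c : ↥hcpKissingPattern | dist (w : E3) (c : E3) = 1} ∩ {c : ↥hcpKissingPattern | dist (b₀ : E3) (c : E3) = 1}).ncard = 2
  · -- path-type corner: the pairing is crystal combinatorially (CORNER PAIRING I/II)
    have hsum := hcp_degree_sum_one_of_diagonal_of_pathType w hpt u v hwu hwv huv_ne huv
    obtain ⟨b₀, hb₀, hdeg2⟩ := hpt
    rcases hnb (τ w) (hL.1 w) with ⟨τ', hL'⟩ | ⟨τ', hL'⟩
    · obtain ⟨w', hw'⟩ := hL'.2.1 i (hL.1 w).symm
      have hτ' : Function.Injective τ' := injective_of_linkIso fcc_contactSeparating hL'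
      exact absurd (not_pathType_of_fcc_neighbour hτ hτ' hL w hL' hw' hb₀ hdeg2) not_false
    · obtain ⟨w', hw'⟩ := hL'.2.1 i (hL.1 w).symm
      exact exists_halfCap_of_pathType_corner hτ hL w hL' hw' hwu hb₀ hwv huv_ne hdeg2 hsum
  · -- matching-type corner: the √3-bound
    have hF2 : ∀ x : ↥hcpKissingPattern, dist (w : E3) (x : E3) = 1 → dist (u : E3) (x : E3) = Real.sqrt 2 → x = v := by
      intro x hwx hux
      by_contra hxv
      exact hpt (hcp_pathType_of_two_diagonal_partners w u x v hwu hwx hwv hux huv hxv)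
    have hS3 : ∀ x : ↥hcpKissingPattern, dist (w : E3) (x : E3) = 1 → u ≠ x → dist (u : E3) (x : E3) ≠ 1 →
        dist (u : E3) (x : E3) ≠ Real.sqrt 2 → dist (u : E3) (x : E3) = Real.sqrt 3 :=
      fun x hwx hne h1 h2 => hcp_dist_sqrt_three_of_corner w u x hpt hwu hwx hne h1 h2
    rcases hnb (τ w) (hL.1 w) with ⟨τ', hL'⟩ | ⟨τ', hL'⟩
    · obtain ⟨w', hw'⟩ := hL'.2.1 i (hL.1 w).symm
      have hτ' : Function.Injective τ' := injective_of_linkIso fcc_contactSeparating hL'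
      obtain ⟨a', ha'w, ha', -⟩ := exists_partner hτ' hL w hL' hw' hwu
      obtain ⟨b', hb'w, hb', -⟩ := exists_partner hτ' hL w hL' hw' hwv
      have hdiag : dist (a' : E3) (b' : E3) = Real.sqrt 2 :=
        noTwist_of_pairBound hcp_contactSeparating fcc_contactSeparating hB hθ hD₀ hnum hy hL w hL' hw' hwu ha' hb'
          (fcc_exists_diagonal_partner w' a' ha'w) hF2 hS3 fcc_ncard_common_contacts_of_diagonal
          (fun u' v' c c' h h1 h2 h3 h4 hne => fcc_common_contacts_not_adj u' v' c c' h h1 h2 h3 h4 hne)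
      exact exists_halfCap_of_diagonal_partners hτ' hL w hL' hw' ha'w hb'w ha' hb' hdiag
        (fcc_ncard_common_contacts_of_diagonal a' b' hdiag)
        (fun c c' h1 h2 h3 h4 hne => fcc_common_contacts_not_adj a' b' c c' hdiag h1 h2 h3 h4 hne)
    · obtain ⟨w', hw'⟩ := hL'.2.1 i (hL.1 w).symm
      have hτ' : Function.Injective τ' := injective_of_linkIso hcp_contactSeparating hL'
      have hLw : LinkIso θ hcpKissingPattern y (τ' w') τ := linkIso_rebase hL hw'
      obtain ⟨a', ha'w, ha', -⟩ := exists_partner hτ' hL w hL' hw' hwu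
      obtain ⟨b', hb'w, hb', -⟩ := exists_partner hτ' hL w hL' hw' hwv
      have hw'np : ¬ ∃ b₀ : ↥hcpKissingPattern, dist (w' : E3) (b₀ : E3) = 1 ∧
          ({c : ↥hcpKissingPattern | dist (w' : E3) (c : E3) = 1} ∩ {c : ↥hcpKissingPattern | dist (b₀ : E3) (c : E3) = 1}).ncard = 2 := by
        rintro ⟨b₀, hb₀, hdeg2⟩
        obtain ⟨b₁, hb₁w, hb₁, -⟩ := exists_partner hτ hL' w' hLw (w' := w) rfl hb₀
        refine hpt ⟨b₁, hb₁w, ?_⟩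
        rw [← ncard_common_contacts_eq_of_shared_bond hτ' hτ hL' w' hLw (w' := w) rfl hb₁]
        exact hdeg2
      have hdiag : dist (a' : E3) (b' : E3) = Real.sqrt 2 :=
        noTwist_of_pairBound hcp_contactSeparating hcp_contactSeparating hB hθ hD₀ hnum hy hL w hL' hw' hwu ha' hb'
          (hcp_exists_diagonal_partner w' a' hw'np ha'w) hF2 hS3 hcp_ncard_common_contacts_of_diagonal
          (fun u' v' c c' h h1 h2 h3 h4 hne => hcp_common_contacts_not_adj u' v' c c' h h1 h2 h3 h4 hne)
      exact exists_halfCap_of_diagonal_partners hτ' hL w hL' hw' ha'w hb'w ha' hb' hdiag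
        (hcp_ncard_common_contacts_of_diagonal a' b' hdiag)
        (fun c c' h1 h2 h3 h4 hne => hcp_common_contacts_not_adj a' b' c c' hdiag h1 h2 h3 h4 hne)

/-! ### §3 `P` from the four scalar bounds, and the column by name -/

/-- ★ **`CapForcing θ` FROM FOUR 12-POINT SCALAR BOUNDS**: `LinkPairBound θ D₀ √3` and `LinkDiagonalBound θ d₀` for fcc and hcp, with the
two numerical lens conditions. [folklore] -/
theorem capForcing_of_scalarBounds {D₀ d₀ : ℝ} (hθ : 0 ≤ θ) (hD₀ : 0 < D₀) (hd₀ : 0 < d₀)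
    (hnum3 : 3 * (((1 + θ) ^ 2) ^ 2 - D₀ ^ 2 / 4) < (1 + θ)⁻¹ ^ 2 - ((((1 + θ) ^ 2) ^ 2 - (1 + θ)⁻¹ ^ 2) / D₀) ^ 2)
    (hnum5 : (5 - Real.sqrt 5) / 2 * (((1 + θ) ^ 2) ^ 2 - d₀ ^ 2 / 4) <
      ((1 + θ)⁻¹ ^ 2) ^ 2 - ((((1 + θ) ^ 2) ^ 2 - (1 + θ)⁻¹ ^ 2) / d₀) ^ 2)
    (hBf : LinkPairBound θ D₀ (Real.sqrt 3) fccKissingPattern) (hBh : LinkPairBound θ D₀ (Real.sqrt 3) hcpKissingPattern)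
    (hDf : LinkDiagonalBound θ d₀ fccKissingPattern) (hDh : LinkDiagonalBound θ d₀ hcpKissingPattern) : CapForcing θ :=
  ⟨capForcingAt_of_halfCap fcc_contactSeparating fcc_ncard_common_contacts_of_diagonal
      (capMatchCert_of_linkDiagonalBound hθ hd₀ hnum5 hDf) (halfCaps_fcc_of_pairBound hBf hθ hD₀ hnum3),
   capForcingAt_of_halfCap hcp_contactSeparating hcp_ncard_common_contacts_of_diagonal
      (capMatchCert_of_linkDiagonalBound hθ hd₀ hnum5 hDh) (halfCaps_hcp_of_pairBound hBh hθ hD₀ hnum3)⟩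

/-- **The three-point lens condition at `θ = 1/100`, `D₀ = 17/10`**: `3·(1.01⁴ − 0.7225) ≈ 0.9543 < 0.9790 ≈ 1.01⁻² − ((1.01⁴ − 1.01⁻²)/1.7)²`.
[folklore] -/
theorem num3_hundredth_seventeen_tenths :
    3 * (((1 + (1 / 100 : ℝ)) ^ 2) ^ 2 - (17 / 10 : ℝ) ^ 2 / 4) <
      (1 + (1 / 100 : ℝ))⁻¹ ^ 2 - ((((1 + (1 / 100 : ℝ)) ^ 2) ^ 2 - (1 + (1 / 100 : ℝ))⁻¹ ^ 2) / (17 / 10 : ℝ)) ^ 2 := by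
  norm_num

/-- ★ **`CapForcing (1/100)` from `LinkPairBound (1/100) (17/10) √3` and `LinkDiagonalBound (1/100) (6/5)`, fcc and hcp.** [folklore] -/
theorem capForcing_hundredth_of_scalarBounds
    (hBf : LinkPairBound (1 / 100) (17 / 10) (Real.sqrt 3) fccKissingPattern)
    (hBh : LinkPairBound (1 / 100) (17 / 10) (Real.sqrt 3) hcpKissingPattern)
    (hDf : LinkDiagonalBound (1 / 100) (6 / 5) fccKissingPattern) (hDh : LinkDiagonalBound (1 / 100) (6 / 5) hcpKissingPattern) :
    CapForcing (1 / 100) :=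
  ⟨capForcingAt_of_halfCap fcc_contactSeparating fcc_ncard_common_contacts_of_diagonal
      (capMatchCert_of_linkDiagonalBound_hundredth hDf) (halfCaps_fcc_of_pairBound hBf (by norm_num) (by norm_num) num3_hundredth_seventeen_tenths),
   capForcingAt_of_halfCap hcp_contactSeparating hcp_ncard_common_contacts_of_diagonal
      (capMatchCert_of_linkDiagonalBound_hundredth hDh) (halfCaps_hcp_of_pairBound hBh (by norm_num) (by norm_num) num3_hundredth_seventeen_tenths)⟩

/-- ★ **`KR2Shape` from `LinkCert(1/100)` (G), the FOUR SCALAR BOUNDS (P) and `CappedCert(1/100,1/20)` fcc/hcp (M).** [folklore] -/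
theorem kr2Shape_of_scalarBounds (hG : LinkCert (1 / 100))
    (hBf : LinkPairBound (1 / 100) (17 / 10) (Real.sqrt 3) fccKissingPattern)
    (hBh : LinkPairBound (1 / 100) (17 / 10) (Real.sqrt 3) hcpKissingPattern)
    (hDf : LinkDiagonalBound (1 / 100) (6 / 5) fccKissingPattern) (hDh : LinkDiagonalBound (1 / 100) (6 / 5) hcpKissingPattern)
    (hMf : CappedCert (1 / 100) (1 / 20) fccKissingPattern) (hMh : CappedCert (1 / 100) (1 / 20) hcpKissingPattern) : KR2Shape :=
  kr2Shape_of_cut (linkClassification_of_linkCert hG) (capForcing_hundredth_of_scalarBounds hBf hBh hDf hDh) (cappedRigidity_of_cert hMf hMh)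

/-- **`AperiodicFrustratedLawGap` (crux of item 27623) BY NAME** from `MuEquilibriumDoor ∧ ChargedEnergyGap`, `LinkCert(1/100)`, the four
scalar bounds and the two capped certificates. [folklore] -/
theorem aperiodicFrustratedLawGap_of_scalarBounds
    (hDoor : Summit.AtomisticToContinuum.Crystallization.Theses.GrainCoreNetworkSplit.MuEquilibriumDoor) (hgap : ChargedEnergyGap)
    (hG : LinkCert (1 / 100))
    (hBf : LinkPairBound (1 / 100) (17 / 10) (Real.sqrt 3) fccKissingPattern)
    (hBh : LinkPairBound (1 / 100) (17 / 10) (Real.sqrt 3) hcpKissingPattern)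
    (hDf : LinkDiagonalBound (1 / 100) (6 / 5) fccKissingPattern) (hDh : LinkDiagonalBound (1 / 100) (6 / 5) hcpKissingPattern)
    (hMf : CappedCert (1 / 100) (1 / 20) fccKissingPattern) (hMh : CappedCert (1 / 100) (1 / 20) hcpKissingPattern) :
    Summit.AtomisticToContinuum.Crystallization.Theses.FrustratedLawDichotomy.AperiodicFrustratedLawGap :=
  aperiodicFrustratedLawGap_of_cut hDoor hgap (linkClassification_of_linkCert hG)
    (capForcing_hundredth_of_scalarBounds hBf hBh hDf hDh) (cappedRigidity_of_cert hMf hMh)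

/-- **Item 26654 `NoFrustratedPeriodicMinimiser`, door-free, from the same statements.** [folklore] -/
theorem noFrustratedPeriodicMinimiser_of_scalarBounds (hgap : ChargedEnergyGap) (hG : LinkCert (1 / 100))
    (hBf : LinkPairBound (1 / 100) (17 / 10) (Real.sqrt 3) fccKissingPattern)
    (hBh : LinkPairBound (1 / 100) (17 / 10) (Real.sqrt 3) hcpKissingPattern)
    (hDf : LinkDiagonalBound (1 / 100) (6 / 5) fccKissingPattern) (hDh : LinkDiagonalBound (1 / 100) (6 / 5) hcpKissingPattern)
    (hMf : CappedCert (1 / 100) (1 / 20) fccKissingPattern) (hMh : CappedCert (1 / 100) (1 / 20) hcpKissingPattern) :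
    Summit.AtomisticToContinuum.Crystallization.Theses.PeriodicChargeSplit.NoFrustratedPeriodicMinimiser :=
  noFrustratedPeriodicMinimiser_of_cut hgap (linkClassification_of_linkCert hG)
    (capForcing_hundredth_of_scalarBounds hBf hBh hDf hDh) (cappedRigidity_of_cert hMf hMh)

end Summit.AtomisticToContinuum.Crystallization.Theorems.FrustratedLawDichotomyScalarBoundsP

end
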